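import Summits.NavierStokesRegularity.NavierStokesRegularity.Theorems.ExtremiserTransienceNearExtremalTransienceExtremiserLiouvilleConstantSpeedSlabRate
import Summits.NavierStokesRegularity.NavierStokesRegularity.Theorems.ExtremiserTransienceNearExtremalTransienceExtremiserLiouvilleConstantSpeedJetH1Kill
import Summits.NavierStokesRegularity.NavierStokesRegularity.Theorems.ExtremiserTransienceNearExtremalTransienceExtremiserLiouvilleConstantSpeedSlabCorrector
import HarnessLib

/-!
# Crux `ExtremiserTransience.NearExtremalTransience` (stmt-NavierStokesRegularity-21883), line `extremiser_liouville`,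
# stub K1b — THE SLAB KILL: an axial residue jet with ONE energetic window is impossible, given the corrector bound

`--supports stmt-NavierStokesRegularity-21883` (helper).  Author: prover seat `ns-el-k1b` (g7).  The slab rate
(`…ConstantSpeedSlabRate.slabRate_of_corrector_bound`: `∫θ_{R,ρ}|Dv|²_F ≤ C/R`) is exactly the `H¹` rate on windows that
g6's `…ConstantSpeedJetH1Kill.axialJet_false_of_H1rate_on_window` consumes: for a window `B(x₁, L₁+1)` inside the unit slab
`{1/2 ≤ y₂ ≤ 6}` its `Rₙ`-dilate lies in `{Rₙ/2 ≤ y₂ ≤ 6Rₙ} ∩ B̄_ρ` where `θ_{Rₙ,ρ} = 1` (`ρ` large), so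
`∫⁻_{B(x₁,L₁+1)}‖D[Rₙ(v(Rₙ·) − c)]‖ₑ² = Rₙ·∫⁻_{B(Rₙx₁,Rₙ(L₁+1))}‖Dv‖ₑ² ≤ C`.

* `lintegral_ball_fderiv_sq_le_of_cutoff` — `∫⁻_{B}‖Dv‖ₑ² ≤ ENNReal.ofReal (∫θ|Dv|²_F)` when `θ = 1` on the ball `B`;
* `axialJet_false_of_energeticWindow_of_corrector_bound` — **constant-speed axial residue (extremal, `v − c ∈ L⁶`, `v → c` at
  infinity, multiplier identity), JET data (slabs square integrable, window energies `≡ E₀ > 0`), the corrector bound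
  `‖∇π[θ_{R,ρ}(v−c)]‖ ≤ C_η/R` for all `R ≥ 1` and `ρ ≥ ρ₀(R)`, a window `B(x₁,L₁+1) ⊆ {1/2 ≤ y₂ ≤ 6}` and radii `Rₙ → ∞`
  with `e₀Rₙ ≤ ∫⁻_{B(Rₙx₁,RₙL₁)}‖v − c‖ₑ²` ⇒ `False`.**
* `axialJet_false_of_energeticWindow` — **the same WITHOUT the corrector hypothesis** (discharged by
  `…ConstantSpeedSlabCorrector.slabCorrector_bound`).
So the (J) alternative of K1b survives only as a PANCAKE jet: no window of unit aspect ratio along the axis ever carries energy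
`≳ R` — in particular every sub-conical (thin) jet is dead, unconditionally.

WHAT THIS IS NOT: K1b is NOT proved; nothing here proves NS regularity. [folklore]
-/

noncomputable section

open Set Filter Topology MeasureTheory Metric Function Real
open scoped ENNReal NNReal Topology InnerProductSpace RealInnerProductSpace ContDiff

namespace Summit.NavierStokesRegularity.NavierStokesRegularity.Theorems

-- the problem directory repeats the summit name (`NavierStokesRegularity/NavierStokesRegularity`)
set_option linter.dupNamespace false

namespace ExtremiserLiouville

open Literature.Analysis.FluidPDE Literature.Analysis
open DepletionLadder.KStar DepletionLadder.KStar.HalfSpace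

variable {v : E3 → E3} {c : E3}

/-- **Ball gradient energy under a cut-off plateau**: if `θ ≥ 0` everywhere and `θ = 1` on the ball `B(x₀, L)`, then
`∫⁻_{B(x₀,L)}‖Dv‖ₑ² ≤ ENNReal.ofReal (∫ θ·|Dv|²_F)` (`‖Dv‖² ≤ |Dv|²_F`; `θ|Dv|²_F` integrable). [folklore] -/
theorem lintegral_ball_fderiv_sq_le_of_cutoff (hv : ContDiff ℝ ∞ v) {θ : E3 → ℝ} (hθ : ContDiff ℝ ∞ θ)
    (hθc : HasCompactSupport θ) (hθ0 : ∀ x, 0 ≤ θ x) {x₀ : E3} {L : ℝ} (hθ1 : ∀ x ∈ ball x₀ L, θ x = 1) :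
    ∫⁻ x in ball x₀ L, ‖fderiv ℝ v x‖ₑ ^ 2 ≤ ENNReal.ofReal (∫ x, θ x * frobeniusNormSq (fderiv ℝ v x)) := by
  have hv1 : ContDiff ℝ 1 v := hv.of_le (by norm_cast)
  have cF : Continuous (fun x => frobeniusNormSq (fderiv ℝ v x)) := continuous_frobeniusNormSq_fderiv hv1 one_ne_zero
  have hi : Integrable (fun x => θ x * frobeniusNormSq (fderiv ℝ v x)) volume :=
    (hθ.continuous.mul cF).integrable_of_hasCompactSupport hθc.mul_right
  have hnn : ∀ x, 0 ≤ θ x * frobeniusNormSq (fderiv ℝ v x) := fun x => mul_nonneg (hθ0 x) (frobeniusNormSq_nonneg _)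
  rw [ofReal_integral_eq_lintegral_ofReal hi (Eventually.of_forall hnn), ← lintegral_indicator measurableSet_ball]
  refine lintegral_mono fun x => ?_
  by_cases hx : x ∈ ball x₀ L
  · rw [indicator_of_mem hx, hθ1 x hx, one_mul]
    have hL : ‖fderiv ℝ v x‖ ^ 2 ≤ frobeniusNormSq (fderiv ℝ v x) := by
      have h := opNorm_le_sqrt_frobeniusNormSq (fderiv ℝ v x)
      calc ‖fderiv ℝ v x‖ ^ 2 ≤ (Real.sqrt (frobeniusNormSq (fderiv ℝ v x))) ^ 2 := by gcongr
        _ = _ := Real.sq_sqrt (frobeniusNormSq_nonneg _)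
    calc ‖fderiv ℝ v x‖ₑ ^ 2 = ENNReal.ofReal (‖fderiv ℝ v x‖ ^ 2) := by
          rw [← ofReal_norm, ← ENNReal.ofReal_pow (norm_nonneg _)]
      _ ≤ ENNReal.ofReal (frobeniusNormSq (fderiv ℝ v x)) := ENNReal.ofReal_le_ofReal hL
  · rw [indicator_of_notMem hx]; exact zero_le

/-- **THE SLAB KILL (conditional on the corrector bound).**  See the module docstring. [folklore] -/
theorem axialJet_false_of_energeticWindow_of_corrector_bound
    (hv : ContDiff ℝ ∞ v) (hdiv : VectorCalculus.IsDivFree v) {M B : ℝ} (hMpos : 0 < M)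
    (hM : ∀ x, ‖v x‖ = M) (hcM : ‖c‖ = M) (hB : ∀ x, ‖fderiv ℝ v x‖ ≤ B)
    (h1 : ∫⁻ x, ‖iteratedFDeriv ℝ 1 v x‖ₑ ^ 2 < ⊤) (h2 : ∫⁻ x, ‖iteratedFDeriv ℝ 2 v x‖ₑ ^ 2 < ⊤)
    (hpos : 0 < M * Real.sqrt (Zen v) * Real.sqrt (Wpa v))
    (hatt : |Jst v| = kStar * M * Real.sqrt (Zen v) * Real.sqrt (Wpa v))
    (μ : Measure E3) [IsFiniteMeasure μ]
    (hμ : ∀ ψ : E3 → E3, ContDiff ℝ ∞ ψ → HasCompactSupport ψ → VectorCalculus.IsDivFree ψ →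
      Jst v * J1 v ψ - kStar ^ 2 * M ^ 2 * (Wpa v * A1 v ψ + Zen v * C1 v ψ) = ∫ x, ⟪v x, ψ x⟫_ℝ ∂μ)
    (hc0 : c 0 = 0) (hc1 : c 1 = 0) (hc2 : c 2 ≠ 0) (hL6 : MemLp (fun x => v x - c) 6 volume)
    (hfar : Tendsto (fun x => v x - c) (cocompact E3) (𝓝 0))
    (hslab : ∀ T : ℝ, 0 < T → Integrable (fun x => {x : E3 | |x 2| ≤ T}.indicator (fun x => ‖v x - c‖ ^ 2) x) volume)
    {E₀ : ℝ} (hE0 : 0 < E₀) (hE : ∀ s : ℝ, (∫ x, deriv Real.smoothTransition (x 2 - s) * ‖v x - c‖ ^ 2) = E₀)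
    {Cη : ℝ} (hCη : 0 ≤ Cη)
    (hcorr : ∀ R : ℝ, 1 ≤ R → ∃ ρ₀ : ℝ, R ≤ ρ₀ ∧ ∀ ρ : ℝ, ρ₀ ≤ ρ → ∀ y : E3,
      ‖gradient (divPotential (fun x : E3 =>
          (Real.smoothTransition (4 * (R⁻¹ * x 2) - 1) * Real.smoothTransition (4 - R⁻¹ * x 2 / 2) * cutoff ρ x) •
            (v x - c))) y‖ ≤ Cη / R)
    {Rn : ℕ → ℝ} (hRn1 : ∀ n, 1 ≤ Rn n) (hRn : Tendsto Rn atTop atTop)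
    {x₁ : E3} {L₁ : ℝ} (hwin : ball x₁ (L₁ + 1) ⊆ {y : E3 | 2⁻¹ ≤ y 2 ∧ y 2 ≤ 6})
    {e₀ : ℝ} (he₀ : 0 < e₀)
    (hlow : ∀ n, ENNReal.ofReal (e₀ * Rn n) ≤ ∫⁻ y in ball (Rn n • x₁) (Rn n * L₁), ‖v y - c‖ₑ ^ 2) :
    False := by
  have hK0 : 0 < kStar := kStar_pos
  -- far field: `‖v − c‖ ≤ κ⋆M/3` beyond radius `r₀`
  obtain ⟨r₀, hr₀⟩ : ∃ r₀ : ℝ, ∀ x : E3, r₀ ≤ ‖x‖ → ‖v x - c‖ ≤ kStar * M / 3 := by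
    have hδ : 0 < kStar * M / 3 := by positivity
    have h : (fun x => v x - c) ⁻¹' Metric.ball (0 : E3) (kStar * M / 3) ∈ cocompact E3 :=
      hfar (Metric.ball_mem_nhds (0 : E3) hδ)
    rw [mem_cocompact] at h
    obtain ⟨Kc, hKc, hKsub⟩ := h
    obtain ⟨ρ, hρ⟩ := (Metric.isBounded_iff_subset_closedBall (0 : E3)).1 hKc.isBounded
    refine ⟨ρ + 1, fun x hx => ?_⟩
    have hxK : x ∉ Kc := fun hmem => by
      have := hρ hmem; rw [mem_closedBall, dist_zero_right] at this; linarith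
    have := hKsub hxK
    rw [mem_preimage, Metric.mem_ball, dist_zero_right] at this
    exact this.le
  -- the slab rate constant
  obtain ⟨C, hC0, hC⟩ := slabRate_of_corrector_bound hv hdiv hMpos hM hcM hB h1 h2 hpos hatt hc0 hc1 hc2 hslab hE0.le hE hCη
  -- choose `n₀` with `Rₙ ≥ 4 r₀` for `n ≥ n₀`, and shift the sequence
  obtain ⟨n₀, hn₀⟩ : ∃ n₀ : ℕ, ∀ n, n₀ ≤ n → 4 * r₀ ≤ Rn n := by
    have h := (hRn.eventually (eventually_ge_atTop (4 * r₀)))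
    rw [eventually_atTop] at h
    exact h
  set Rn' : ℕ → ℝ := fun n => Rn (n + n₀) with hRn'
  have hRn1' : ∀ n, 1 ≤ Rn' n := fun n => hRn1 _
  have hRn'' : Tendsto Rn' atTop atTop := hRn.comp (tendsto_add_atTop_nat n₀)
  have hlow' : ∀ n, ENNReal.ofReal e₀ ≤ ∫⁻ x in ball x₁ L₁, ‖Rn' n • (v (Rn' n • x) - c)‖ₑ ^ 2 := by
    intro n
    have hR0 : 0 < Rn' n := one_pos.trans_le (hRn1' n)
    rw [lintegral_ball_blowDown_sq' v c hR0 x₁ L₁]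
    calc ENNReal.ofReal e₀ = ENNReal.ofReal (Rn' n)⁻¹ * ENNReal.ofReal (e₀ * Rn' n) := by
          rw [← ENNReal.ofReal_mul (inv_nonneg.2 hR0.le), mul_comm e₀, ← mul_assoc, inv_mul_cancel₀ hR0.ne', one_mul]
      _ ≤ ENNReal.ofReal (Rn' n)⁻¹ * ∫⁻ y in ball (Rn' n • x₁) (Rn' n * L₁), ‖v y - c‖ₑ ^ 2 :=
          mul_le_mul' le_rfl (hlow (n + n₀))
  -- the `H¹` rate on the window
  have hDV2 : ∀ n, ∫⁻ x in ball x₁ (L₁ + 1), ‖fderiv ℝ (fun x => Rn' n • (v (Rn' n • x) - c)) x‖ₑ ^ 2 ≤ ENNReal.ofReal C := by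
    intro n
    set R : ℝ := Rn' n with hRdef
    have hR1 : 1 ≤ R := hRn1' n
    have hR0 : 0 < R := one_pos.trans_le hR1
    have hR4 : 4 * r₀ ≤ R := hn₀ (n + n₀) (Nat.le_add_left _ _)
    have hvd : Differentiable ℝ v := (hv.of_le (by norm_cast) : ContDiff ℝ 1 v).differentiable one_ne_zero
    rw [lintegral_ball_fderiv_blowDown_sq hvd c hR0 x₁ (L₁ + 1)]
    -- far field on the slab of scale `R`
    have hσR : ∀ x : E3, R / 4 ≤ x 2 → ‖v x - c‖ ≤ kStar * M / 3 := fun x hx =>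
      hr₀ x ((by linarith : r₀ ≤ R / 4).trans (norm_ge_of_mem_slab hx))
    -- the radius `ρ`
    obtain ⟨ρ₀, hρ₀R, hρ₀⟩ := hcorr R hR1
    set ρ : ℝ := max ρ₀ (R * (‖x₁‖ + (L₁ + 1))) with hρdef
    have hρρ₀ : ρ₀ ≤ ρ := le_max_left _ _
    have hRρ : R ≤ ρ := hρ₀R.trans hρρ₀
    have hρ0 : 0 < ρ := hR0.trans_le hRρ
    obtain ⟨-, hgrad⟩ := hC R ρ hR1 hRρ hσR (hρ₀ ρ hρρ₀)
    -- the cut-off is `1` on the dilated window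
    set θ : E3 → ℝ := fun x : E3 => Real.smoothTransition (4 * (R⁻¹ * x 2) - 1) * Real.smoothTransition (4 - R⁻¹ * x 2 / 2) *
      cutoff ρ x with hθdef
    have hθ1 : ∀ y ∈ ball (R • x₁) (R * (L₁ + 1)), θ y = 1 := by
      intro y hy
      have hy' : R⁻¹ • y ∈ ball x₁ (L₁ + 1) := by
        rw [mem_ball, dist_eq_norm] at hy ⊢
        have : R⁻¹ • y - x₁ = R⁻¹ • (y - R • x₁) := by
          rw [smul_sub, smul_smul, inv_mul_cancel₀ hR0.ne', one_smul]
        rw [this, norm_smul, Real.norm_eq_abs, abs_of_pos (inv_pos.2 hR0), inv_mul_lt_iff₀ hR0]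
        exact hy
      have hw := hwin hy'
      simp only [mem_setOf_eq, PiLp.smul_apply, smul_eq_mul] at hw
      have e : R * (R⁻¹ * y 2) = y 2 := by field_simp
      have hy1 : R / 2 ≤ y 2 := by
        have := mul_le_mul_of_nonneg_left hw.1 hR0.le
        rw [e] at this; linarith
      have hy2 : y 2 ≤ 6 * R := by
        have := mul_le_mul_of_nonneg_left hw.2 hR0.le
        rw [e] at this; linarith
      have hyn : ‖y‖ ≤ ρ := by
        rw [mem_ball, dist_eq_norm] at hy
        calc ‖y‖ = ‖(y - R • x₁) + R • x₁‖ := by rw [sub_add_cancel]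
          _ ≤ ‖y - R • x₁‖ + ‖R • x₁‖ := norm_add_le _ _
          _ ≤ R * (L₁ + 1) + R * ‖x₁‖ := by
              rw [norm_smul, Real.norm_eq_abs, abs_of_pos hR0]; linarith
          _ = R * (‖x₁‖ + (L₁ + 1)) := by ring
          _ ≤ ρ := le_max_right _ _
      exact axialCutoff_eq_one hR0 hρ0 hy1 hy2 hyn
    have hθ : ContDiff ℝ ∞ θ := contDiff_axialCutoff R ρ
    have hθc : HasCompactSupport θ := hasCompactSupport_axialCutoff R hρ0
    have hθ0 : ∀ x, 0 ≤ θ x := fun x => (axialCutoff_nonneg_le_one R ρ x).1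
    have hball := lintegral_ball_fderiv_sq_le_of_cutoff hv hθ hθc hθ0 hθ1
    calc ENNReal.ofReal R * ∫⁻ y in ball (R • x₁) (R * (L₁ + 1)), ‖fderiv ℝ v y‖ₑ ^ 2
        ≤ ENNReal.ofReal R * ENNReal.ofReal (∫ x, θ x * frobeniusNormSq (fderiv ℝ v x)) := mul_le_mul' le_rfl hball
      _ ≤ ENNReal.ofReal R * ENNReal.ofReal (C / R) := mul_le_mul' le_rfl (ENNReal.ofReal_le_ofReal hgrad)
      _ = ENNReal.ofReal C := by
          rw [← ENNReal.ofReal_mul hR0.le, mul_div_cancel₀ _ hR0.ne']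
  exact axialJet_false_of_H1rate_on_window hv hdiv hM h1 h2 hpos μ hμ hc0 hc1 hc2 hcM hL6 hslab hE0 hE hRn1' hRn''
    x₁ L₁ ENNReal.ofReal_ne_top hDV2 he₀ hlow'

/-- **THE SLAB KILL (unconditional).**  Constant-speed axial residue JET (extremal, bounded gradient, `v − c ∈ L⁶`, `v → c` at
infinity, multiplier identity, slabs square integrable, window energies `≡ E₀ > 0`), a window `B(x₁, L₁+1) ⊆ {1/2 ≤ y₂ ≤ 6}` and
radii `Rₙ ≥ 1`, `Rₙ → ∞` with `e₀Rₙ ≤ ∫⁻_{B(Rₙx₁,RₙL₁)}‖v − c‖ₑ²` ⇒ `False`.  (K1b itself is NOT proved: pancake jets and the flat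
alternative remain.) [folklore] -/
theorem axialJet_false_of_energeticWindow
    (hv : ContDiff ℝ ∞ v) (hdiv : VectorCalculus.IsDivFree v) {M B : ℝ} (hMpos : 0 < M)
    (hM : ∀ x, ‖v x‖ = M) (hcM : ‖c‖ = M) (hB : ∀ x, ‖fderiv ℝ v x‖ ≤ B)
    (h1 : ∫⁻ x, ‖iteratedFDeriv ℝ 1 v x‖ₑ ^ 2 < ⊤) (h2 : ∫⁻ x, ‖iteratedFDeriv ℝ 2 v x‖ₑ ^ 2 < ⊤)
    (hpos : 0 < M * Real.sqrt (Zen v) * Real.sqrt (Wpa v))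
    (hatt : |Jst v| = kStar * M * Real.sqrt (Zen v) * Real.sqrt (Wpa v))
    (μ : Measure E3) [IsFiniteMeasure μ]
    (hμ : ∀ ψ : E3 → E3, ContDiff ℝ ∞ ψ → HasCompactSupport ψ → VectorCalculus.IsDivFree ψ →
      Jst v * J1 v ψ - kStar ^ 2 * M ^ 2 * (Wpa v * A1 v ψ + Zen v * C1 v ψ) = ∫ x, ⟪v x, ψ x⟫_ℝ ∂μ)
    (hc0 : c 0 = 0) (hc1 : c 1 = 0) (hc2 : c 2 ≠ 0) (hL6 : MemLp (fun x => v x - c) 6 volume)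
    (hfar : Tendsto (fun x => v x - c) (cocompact E3) (𝓝 0))
    (hslab : ∀ T : ℝ, 0 < T → Integrable (fun x => {x : E3 | |x 2| ≤ T}.indicator (fun x => ‖v x - c‖ ^ 2) x) volume)
    {E₀ : ℝ} (hE0 : 0 < E₀) (hE : ∀ s : ℝ, (∫ x, deriv Real.smoothTransition (x 2 - s) * ‖v x - c‖ ^ 2) = E₀)
    {Rn : ℕ → ℝ} (hRn1 : ∀ n, 1 ≤ Rn n) (hRn : Tendsto Rn atTop atTop)
    {x₁ : E3} {L₁ : ℝ} (hwin : ball x₁ (L₁ + 1) ⊆ {y : E3 | 2⁻¹ ≤ y 2 ∧ y 2 ≤ 6})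
    {e₀ : ℝ} (he₀ : 0 < e₀)
    (hlow : ∀ n, ENNReal.ofReal (e₀ * Rn n) ≤ ∫⁻ y in ball (Rn n • x₁) (Rn n * L₁), ‖v y - c‖ₑ ^ 2) :
    False := by
  obtain ⟨Cη, hCη, hcorr⟩ := slabCorrector_bound hv hdiv hMpos hM hcM hc0 hc1 hc2 hslab hE0.le hE
  exact axialJet_false_of_energeticWindow_of_corrector_bound hv hdiv hMpos hM hcM hB h1 h2 hpos hatt μ hμ hc0 hc1 hc2 hL6
    hfar hslab hE0 hE hCη hcorr hRn1 hRn hwin he₀ hlow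

end ExtremiserLiouville

end Summit.NavierStokesRegularity.NavierStokesRegularity.Theorems

end
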